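import Literature.AnabelianGeometry.SemiGraphs.PSCGraphicity
import Mathlib.Tactic.Group
import HarnessLib

/-!
# [CombGC] Prop. 1.5 (i) (incidence of edge-like subgroups) for a PSC datum: a group-theoretic criterion

Mochizuki, *A combinatorial version of the Grothendieck conjecture* [CombGC] §1, Prop. 1.5 (i), p. 12
[cite: MochizukiCombGC2007, Prop 1.5(i) p.12]: "An edge-like subgroup of `Π_G` is cuspidal (respectively,
not cuspidal) if and only if it is contained in precisely one (respectively, precisely two) verticial
subgroup(s)."  For a datum `G : PSCDatum Π` (`PSCFundamentalGroup.lean`, abc-iut-L3-t4) whose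
representatives are chosen compatibly (each `Π_e`, `e` a node, inside the representatives `Π_{u₁}`,
`Π_{u₂}` of its two DISTINCT end vertices — no loops; each `Π_c` inside the representative of its
vertex), the typed predicate `EdgeLikeIncidence` follows from:

* MALNORMALITY of the verticial representatives (`Π_v ∩ gΠ_vg⁻¹ ≠ 1 ⇒ g ∈ Π_v`) — this is where
  free-factor malnormality (Ribes–Zalesskii 9.1.12, `ProSigmaFreeFactorMalnormal.lean`) enters at genuine
  multi-vertex curves: it makes the verticial subgroup(s) containing a given edge group UNIQUE;
* non-triviality of the edge groups, everywhere-disjointness of node groups from cusp groups, and of each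
  edge group from the conjugates of the verticial groups of the vertices it does not abut to.

`edgeLikeIncidence_of` is the criterion; the instance at the two-tripod datum is
`PSCTwoTripodIncidence.lean`.  PROOF-ONLY; no side is taken on [IUTchIII] Cor. 3.12.
-/

namespace Literature.AnabelianGeometry.SemiGraphs

namespace PSCDatum

open scoped Pointwise

universe u

variable {P : Type u} [Group P] [TopologicalSpace P]

/-! ### Pointwise-conjugation helpers -/

omit [TopologicalSpace P] in
/-- `γX ≤ δY ↔ X ≤ (γ⁻¹δ)Y`. [cite: MochizukiCombGC2007, Prop 1.5(i) p.12] -/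
theorem smul_le_smul_iff_le_inv_mul_smul (γ δ : ConjAct P) (X Y : Subgroup P) :
    γ • X ≤ δ • Y ↔ X ≤ (γ⁻¹ * δ) • Y := by
  conv_lhs => rw [show δ = γ * (γ⁻¹ * δ) by rw [mul_inv_cancel_left], mul_smul]
  exact Subgroup.pointwise_smul_le_pointwise_smul_iff

omit [TopologicalSpace P] in
/-- An element of `Y` conjugates `Y` to itself. [cite: MochizukiCombGC2007, Prop 1.5(i) p.12] -/
theorem conj_smul_eq_self_of_mem {Y : Subgroup P} {g : P} (hg : g ∈ Y) :
    ConjAct.toConjAct g • Y = Y := by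
  ext z
  rw [Subgroup.mem_smul_pointwise_iff_exists]
  constructor
  · rintro ⟨s, hs, rfl⟩
    rw [ConjAct.toConjAct_smul]
    exact Y.mul_mem (Y.mul_mem hg hs) (Y.inv_mem hg)
  · intro hz
    refine ⟨g⁻¹ * z * g, Y.mul_mem (Y.mul_mem (Y.inv_mem hg) hz) hg, ?_⟩
    rw [ConjAct.toConjAct_smul]
    group

omit [TopologicalSpace P] in
/-- **Uniqueness from malnormality**: if `Y` is malnormal (`Y ∩ gYg⁻¹ ≠ 1 ⇒ g ∈ Y`) and a non-trivial
`X ≤ Y` also lies in `δY`, then `δY = Y`. [cite: MochizukiCombGC2007, Prop 1.5(i) p.12] -/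
theorem smul_eq_of_le_of_le_smul {X Y : Subgroup P}
    (hmal : ∀ g : P, Y ⊓ ConjAct.toConjAct g • Y ≠ ⊥ → g ∈ Y) (hX : X ≠ ⊥) (hXY : X ≤ Y)
    (δ : ConjAct P) (hXδ : X ≤ δ • Y) : δ • Y = Y := by
  have hne : Y ⊓ ConjAct.toConjAct (ConjAct.ofConjAct δ) • Y ≠ ⊥ := by
    rw [ConjAct.toConjAct_ofConjAct]
    intro h
    exact hX (le_bot_iff.mp (h ▸ le_inf hXY hXδ))
  have := conj_smul_eq_self_of_mem (hmal _ hne)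
  rwa [ConjAct.toConjAct_ofConjAct] at this

/-! ### The criterion -/

/-- **Prop. 1.5 (i) from malnormal verticial representatives and incidence data.**  Hypotheses: every
`Π_v` is malnormal; each node group `Π_e ≠ 1` lies in the representatives of two vertices `u₁ ≠ u₂` with
`Π_{u₁} ≠ Π_{u₂}`, and meets every conjugate of `Π_w` (`w ∉ {u₁,u₂}`) and of every cusp group
trivially; each cusp group `Π_c ≠ 1` lies in the representative of one vertex `u` and meets every
conjugate of `Π_w` (`w ≠ u`) trivially.  Then: a cuspidal subgroup lies in exactly one verticial
subgroup, a nodal one in exactly two. [cite: MochizukiCombGC2007, Prop 1.5(i) p.12] -/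
theorem edgeLikeIncidence_of (G : PSCDatum P)
    (hmal : ∀ (v : G.graph.V) (g : P),
      G.vertGp v ⊓ ConjAct.toConjAct g • G.vertGp v ≠ ⊥ → g ∈ G.vertGp v)
    (hNbot : ∀ e, G.nodeGp e ≠ ⊥) (hCbot : ∀ c, G.cuspGp c ≠ ⊥)
    (hNC : ∀ (e : G.graph.N) (c : G.graph.C) (g : P),
      G.nodeGp e ⊓ ConjAct.toConjAct g • G.cuspGp c = ⊥)
    (hNends : ∀ e : G.graph.N, ∃ u₁ u₂ : G.graph.V, G.nodeGp e ≤ G.vertGp u₁ ∧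
      G.nodeGp e ≤ G.vertGp u₂ ∧ G.vertGp u₁ ≠ G.vertGp u₂ ∧
      ∀ w, w ≠ u₁ → w ≠ u₂ → ∀ g : P, G.nodeGp e ⊓ ConjAct.toConjAct g • G.vertGp w = ⊥)
    (hCend : ∀ c : G.graph.C, ∃ u : G.graph.V, G.cuspGp c ≤ G.vertGp u ∧
      ∀ w, w ≠ u → ∀ g : P, G.cuspGp c ⊓ ConjAct.toConjAct g • G.vertGp w = ⊥) :
    G.EdgeLikeIncidence := by
  -- an edge group inside `δ Π_w` with `w` not an end vertex is impossible
  have key : ∀ (X : Subgroup P) (w : G.graph.V), X ≠ ⊥ →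
      (∀ g : P, X ⊓ ConjAct.toConjAct g • G.vertGp w = ⊥) → ∀ δ : ConjAct P, ¬ X ≤ δ • G.vertGp w := by
    intro X w hX h δ hle
    apply hX
    have := h (ConjAct.ofConjAct δ)
    rw [ConjAct.toConjAct_ofConjAct] at this
    exact le_bot_iff.mp (this ▸ le_inf le_rfl hle)
  intro E hE
  rcases hE with ⟨e, γ, rfl⟩ | ⟨c, γ, rfl⟩
  · -- nodal
    obtain ⟨u₁, u₂, h₁, h₂, hne, hoth⟩ := hNends e
    have hnotcusp : ¬ G.IsCuspidal (γ • G.nodeGp e) := by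
      rintro ⟨c, δ, hδ⟩
      apply hNbot e
      have h0 := hNC e c (ConjAct.ofConjAct (γ⁻¹ * δ))
      rw [ConjAct.toConjAct_ofConjAct] at h0
      have hle : G.nodeGp e ≤ (γ⁻¹ * δ) • G.cuspGp c := by
        rw [← smul_le_smul_iff_le_inv_mul_smul, hδ]
      exact le_bot_iff.mp (h0 ▸ le_inf le_rfl hle)
    -- the verticial subgroups containing `γ Π_e` are exactly `γ Π_{u₁}`, `γ Π_{u₂}`
    have hchar : ∀ A : Subgroup P, (G.IsVerticial A ∧ γ • G.nodeGp e ≤ A) ↔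
        (A = γ • G.vertGp u₁ ∨ A = γ • G.vertGp u₂) := by
      intro A
      constructor
      · rintro ⟨⟨w, δ, rfl⟩, hle⟩
        rw [smul_le_smul_iff_le_inv_mul_smul] at hle
        by_cases hw₁ : w = u₁
        · subst hw₁
          left
          rw [show δ = γ * (γ⁻¹ * δ) by rw [mul_inv_cancel_left], mul_smul,
            smul_eq_of_le_of_le_smul (hmal w) (hNbot e) h₁ _ hle]
        by_cases hw₂ : w = u₂
        · subst hw₂
          right
          rw [show δ = γ * (γ⁻¹ * δ) by rw [mul_inv_cancel_left], mul_smul,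
            smul_eq_of_le_of_le_smul (hmal w) (hNbot e) h₂ _ hle]
        exact absurd hle (key _ w (hNbot e) (hoth w hw₁ hw₂) _)
      · rintro (rfl | rfl)
        · exact ⟨⟨u₁, γ, rfl⟩, Subgroup.pointwise_smul_le_pointwise_smul_iff.mpr h₁⟩
        · exact ⟨⟨u₂, γ, rfl⟩, Subgroup.pointwise_smul_le_pointwise_smul_iff.mpr h₂⟩
    have hne' : γ • G.vertGp u₁ ≠ γ • G.vertGp u₂ := fun h =>
      hne (smul_left_cancel γ h)
    refine ⟨⟨fun h => absurd h hnotcusp, fun ⟨A, hA, huniq⟩ => ?_⟩,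
      ⟨fun _ => ⟨_, _, hne', hchar⟩, fun _ => hnotcusp⟩⟩
    -- uniqueness fails: both `γ Π_{u₁}` and `γ Π_{u₂}` qualify
    have e₁ := huniq _ ((hchar _).mpr (Or.inl rfl))
    have e₂ := huniq _ ((hchar _).mpr (Or.inr rfl))
    exact absurd (e₁.trans e₂.symm) hne'
  · -- cuspidal
    obtain ⟨u, hu, hoth⟩ := hCend c
    have hcusp : G.IsCuspidal (γ • G.cuspGp c) := ⟨c, γ, rfl⟩
    -- the unique verticial subgroup containing `γ Π_c` is `γ Π_u`
    have hchar : ∀ A : Subgroup P, (G.IsVerticial A ∧ γ • G.cuspGp c ≤ A) ↔ A = γ • G.vertGp u := by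
      intro A
      constructor
      · rintro ⟨⟨w, δ, rfl⟩, hle⟩
        rw [smul_le_smul_iff_le_inv_mul_smul] at hle
        by_cases hw : w = u
        · subst hw
          rw [show δ = γ * (γ⁻¹ * δ) by rw [mul_inv_cancel_left], mul_smul,
            smul_eq_of_le_of_le_smul (hmal w) (hCbot c) hu _ hle]
        · exact absurd hle (key _ w (hCbot c) (hoth w hw) _)
      · rintro rfl
        exact ⟨⟨u, γ, rfl⟩, Subgroup.pointwise_smul_le_pointwise_smul_iff.mpr hu⟩
    refine ⟨⟨fun _ => ⟨γ • G.vertGp u, (hchar _).mpr rfl, fun A hA => (hchar A).mp hA⟩,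
      fun _ => hcusp⟩, ⟨fun h => absurd hcusp h, ?_⟩⟩
    rintro ⟨A₁, A₂, hne, hall⟩
    have e₁ : A₁ = γ • G.vertGp u := (hchar _).mp ((hall A₁).mpr (Or.inl rfl))
    have e₂ : A₂ = γ • G.vertGp u := (hchar _).mp ((hall A₂).mpr (Or.inr rfl))
    exact absurd (e₁.trans e₂.symm) hne

end PSCDatum

end Literature.AnabelianGeometry.SemiGraphs
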